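import Literature.Analysis.FluidPDE.HardSphereDynamics
import HarnessLib

/-!
# The collision-by-collision construction of the hard-sphere flow (Alexander's theorem, plan)

`Literature.Analysis.FluidPDE.HardSphereDynamics` records **Alexander's theorem** on the flat
torus as the named fact `Kinetic.HardSphereFlow.nonempty_torus`: for `0 < ε < 1/2` and every `N`
the hypothesis structure `Kinetic.HardSphereFlow (Torus.geometry d) ε N` is inhabited (an a.e.
defined, measurable, Liouville-preserving group of hard-sphere trajectories). That fact bundles
three theorems of the printed literature —

1. (Alexander 1975; Cercignani–Illner–Pulvirenti 1994, Thm. 4.2.1 and App. 4.A;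
   Gallagher–Saint-Raymond–Texier 2013, Prop. 4.1.1) the set of initial data leading, forward or
   backward in time, to a multiple or grazing collision or to an accumulation of collision
   instants is Lebesgue-null;
2. (CIP 1994 §4.2, p. 65) on the complement `Γ₀` the free flight and the elastic reflection law
   determine a group `T^t` of trajectories;
3. (CIP 1994 §4.2 and App. 4.A, "special flow representation"; GST 2013, proof of Prop. 4.1.1,
   "the measure is invariant by the flow") `T^t` preserves the Liouville measure —

and its proof is a theory rather than a lemma. This file is the first layer of that theory: it
*constructs* the candidate flow explicitly, for an arbitrary `Kinetic.Geometry`, as in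
CIP 1994 App. 4.A (free flight up to the exit time from the hard-sphere domain, then the
reflection `R` of the incoming contact pair, iterated; backward in time by the velocity flip,
CIP 1994 (2.3)), defines its good set `Γ₀`, and reduces `nonempty_torus` to five named facts
about this construction, one per cluster of fields of `HardSphereFlow`
(`HardSphereFlow.nonempty_torus_of_construction`, proved here). The five facts are to be
discharged in sibling files.

* `Kinetic.Alexander.freeExitTime G ε z : ℝ≥0∞` — `τ(z) = inf {t ≥ 0 | S_t z ∉ D_ε^N}`, the first
  exit time of the free flight from the (closed) hard-sphere domain (`∞` if it never exits;
  CIP's ceiling function `a(y)`).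
* `Kinetic.Alexander.incomingPairs G ε z` — the ordered pairs `i < j` in contact with incoming
  velocities (CIP's `Σ⁻`, GST's pre-collisional configurations).
* `Kinetic.Alexander.collisionStep G ε` — free flight for time `τ(z)`, then the elastic
  reflection of an incoming contact pair (the identity if `τ(z) = ∞`).
* `Kinetic.Alexander.stateAfter G ε z k`, `collisionInstant G ε z k`, `collisionCount G ε z t`,
  `collisionCountBefore G ε z t`, `fwdFlow G ε z t`, `fwdFlowLeft G ε z t` — the `k`-th
  post-collisional state `z_k = T^k z`, the `k`-th collision instant `t_k = ∑_{m<k} τ(z_m)`, the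
  number of collisions in `[0, t]` resp. `[0, t)`, the forward flow `S_{t - t_k} z_k` on
  `[t_k, t_{k+1})` (right-continuous, as `IsHardSphereTrajectory` demands) and its
  left-continuous version (pre-collisional values at the instants).
* `Kinetic.Alexander.flow G ε t z` — the two-sided flow: `fwdFlow` for `t ≥ 0` and, for `t < 0`,
  the velocity flip of the left-continuous forward flow of `flipVel z` at `-t` (CIP 1994 (2.3),
  `T^{-t} = S T^t S`; the left-continuous version makes backward orbits right-continuous). No
  topology enters the definition.
* `Kinetic.Alexander.IsSimpleIncoming`, `FwdGood`, `good` — the good set `Γ₀`: every forward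
  collision of `z` and of `flipVel z` is *simple* (exactly one unordered pair in contact, with
  incoming velocities: no multiple, no simultaneous, no grazing collision), no contact occurs
  strictly inside a free-flight segment (no grazing touch), the collision instants do not
  accumulate (`∑ τ(z_k) = ∞`), and at time `0` the contact pairs of `z` (at most one) are
  outgoing (the right-continuity convention: the value of a trajectory at a collision time is
  post-collisional).
* named facts (torus, `0 < ε < 1/2`): `torusFlow_group` (2. above: `Γ₀` invariant, `T⁰ = id`,
  `T^{s+t} = T^s T^t`), `torusFlow_isTrajectory` (orbits of good points are hard-sphere
  trajectories in the sense of `Kinetic.IsHardSphereTrajectory`), `torusFlow_measurable` (Borel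
  measurability of `Γ₀` and of each `T^t`), `torusFlow_ae_good` (1. above, Alexander's theorem
  proper), `torusFlow_measurePreserving` (3. above).
* `Kinetic.HardSphereFlow.nonempty_torus_of_construction` — the five facts imply
  `HardSphereFlow.nonempty_torus` (proved).

## Mathlib / Literature reuse

Everything static (`Config`, `hardSphereDomain`, `contactSet`, `IsIncoming`, `IsOutgoing`,
`freeFlight`, `collidePair`, `liouville`) is `HardSpherePhaseSpace`'s; `flipVel`, `timeReverse`,
`IsHardSphereTrajectory`, `HardSphereFlow` are `HardSphereDynamics`'. Times live in `ℝ≥0∞`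
(`sInf`, finite sums and `tsum` always defined); `Nat.iterate`, `sSup` on `ℕ`,
`Set.Nonempty.some` are Mathlib's. Mathlib has no billiard flow (grep `billiard`: nothing).

## Design choices

* The construction is stated for an arbitrary `Geometry`: no topology or measurability is needed
  to *define* it (backward orbits use the algebraic left-continuous forward flow `fwdFlowLeft`
  rather than `Function.leftLim`, which also keeps measurability elementary). The facts are
  stated for `Torus.geometry d` and `0 < ε < 1/2` only, like `nonempty_torus`: for an abstract
  geometry they are false, and `ε < 1/2` makes the minimal-image separation vector odd near
  contact, so that `IsIncoming`/`collidePair` do not depend on the order of a pair.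
* Pair selection in `collisionStep` uses `Set.Nonempty.some` on the ordered incoming contact
  pairs `i < j`; on the good set that set is a singleton (`IsSimpleIncoming`), so no choice is
  actually made there. Off the good set all values are junk, as in `HardSphereFlow`.
* `collisionCount z t = sSup {k | t_k ≤ t}` is the honest number of collisions in `[0, t]` when
  `t_k → ∞`; for a Zeno orbit the set is unbounded and `sSup` returns the junk value `0`.
* The good set is *defined* by the deterministic conditions under which the orbit is a
  hard-sphere trajectory, not as "the complement of the pathological set" of GST 2013: the two
  differ by the conventions at time `0` (contact-incoming and grazing-contact initial data are
  excluded, being left limits rather than values of trajectories) and by simultaneous disjoint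
  binary collisions (excluded here since `IsHardSphereTrajectory.binary` asks for a single contact
  pair at each collision time); all these sets are Liouville-null, and `torusFlow_ae_good`
  states exactly what `HardSphereFlow.measure_compl_good` consumes.
* Faithfulness to `HardSphereFlow`: the five facts are literally its field clusters for this
  particular `flow`/`good`, so `nonempty_torus_of_construction` is bookkeeping; the mathematics
  is in discharging them (restart and reversibility lemmas for `torusFlow_group` /
  `torusFlow_isTrajectory`; the cylinder change of variables `x = ε n - τ v`,
  `dx = ε^{d-1} |v · n| dσ(n) dτ` and Poincaré recurrence, Mathlib's `MeasureTheory.Conservative`,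
  for `torusFlow_ae_good` / `torusFlow_measurePreserving`, following CIP 1994 App. 4.A).

## References

* R. K. Alexander, *The infinite hard sphere system*, PhD thesis, UC Berkeley (1975).
* C. Cercignani, R. Illner, M. Pulvirenti, *The Mathematical Theory of Dilute Gases*, Springer
  (1994), §4.2 (Thm. 4.2.1, the flow `T^t` on `Γ₀`, (2.3)), Appendix 4.A (pp. 107–111: special
  flow representation, the torus case).
* I. Gallagher, L. Saint-Raymond, B. Texier, *From Newton to Boltzmann: hard spheres and
  short-range potentials*, EMS (2013), Ch. 4 §4.1, Prop. 4.1.1, Lemma 4.1.2.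
-/

open MeasureTheory Set Filter Topology Function
open scoped ENNReal

namespace Literature.Analysis.FluidPDE

noncomputable section

section Kinetic

variable {d : Type*} [Fintype d] {X : Type*} {N : ℕ}

namespace Alexander

variable (G : Geometry d X) (ε : ℝ)

/-! ## One collision step -/

/-- The first exit time of the free flight from the closed hard-sphere domain:
`τ(z) = inf {t ≥ 0 | S_t z ∉ D_ε^N} ∈ [0, ∞]` (`∞` if the free flight never leaves the domain).
For `z ∈ D_ε^N` this is the time of the next collision (CIP 1994 App. 4.A, the ceiling function
`a(y)`, p. 108 and p. 111). [cite: CIP1994, App. 4.A p. 108] -/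
def freeExitTime (z : Config N d X) : ℝ≥0∞ :=
  sInf {t : ℝ≥0∞ | t ≠ ∞ ∧ freeFlight G t.toReal z ∉ hardSphereDomain G N ε}

/-- The ordered pairs `i < j` that are in contact with incoming (pre-collisional) velocities in
`z` (CIP 1994 App. 4.A, the incoming boundary `Σ⁻ = ⋃ Σ⁻_{ij}`, p. 110; GST 2013 §4.1). [cite: CIP1994, App. 4.A p. 110] -/
def incomingPairs (z : Config N d X) : Set (Fin N × Fin N) :=
  {p | p.1 < p.2 ∧ z ∈ contactSet G N ε p.1 p.2 ∧ IsIncoming G z p.1 p.2}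

/-- Membership in `incomingPairs`. [folklore] -/
theorem mem_incomingPairs {G : Geometry d X} {ε : ℝ} {z : Config N d X} {p : Fin N × Fin N} :
    p ∈ incomingPairs G ε z ↔ p.1 < p.2 ∧ z ∈ contactSet G N ε p.1 p.2 ∧ IsIncoming G z p.1 p.2 :=
  Iff.rfl

open Classical in
/-- One step of the hard-sphere dynamics (CIP 1994 App. 4.A p. 111, the boundary map
`T y = R⁻¹ φ_{a(y)}(y)` composed with the reflection `R : Σ⁻ → Σ⁺`): free flight for the exit
time `τ(z)`, then the elastic reflection `collidePair` of an incoming contact pair of the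
configuration reached. If `τ(z) = ∞` (no further collision) the step is the identity; if no
incoming contact pair is present at the exit point (impossible on the torus for `z ∈ D_ε^N`) no
reflection is applied. On the good set the incoming contact pair is unique
(`IsSimpleIncoming`), so the use of `Set.Nonempty.some` is not a choice there. [cite: CIP1994, App. 4.A p. 111] -/
def collisionStep (z : Config N d X) : Config N d X :=
  if freeExitTime G ε z = ∞ then z
  else
    let z' := freeFlight G (freeExitTime G ε z).toReal z
    if h : (incomingPairs G ε z').Nonempty then collidePair G h.some.1 h.some.2 z' else z'

/-! ## Iteration: post-collisional states, collision instants, the forward flow -/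

/-- The `k`-th post-collisional state `z_k = T^k z` of the forward dynamics started at `z`
(`z_0 = z`; CIP 1994 App. 4.A, iterates `T^k y`). [cite: CIP1994, App. 4.A p. 109] -/
def stateAfter (z : Config N d X) (k : ℕ) : Config N d X :=
  (collisionStep G ε)^[k] z

/-- The `k`-th collision instant `t_k = ∑_{m < k} τ(z_m) ∈ [0, ∞]` of the forward dynamics
started at `z` (`t_0 = 0`; CIP 1994 App. 4.A, the partial sums `∑ a(T^k y)`). [cite: CIP1994, App. 4.A p. 109] -/
def collisionInstant (z : Config N d X) (k : ℕ) : ℝ≥0∞ :=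
  ∑ m ∈ Finset.range k, freeExitTime G ε (stateAfter G ε z m)

/-- The number of collisions of the forward dynamics in the closed time window `[0, t]`: the
largest `k` with `t_k ≤ t` (junk value `0` — Mathlib's `sSup` of an unbounded set of naturals —
when the collision instants accumulate before `t`, which does not happen on the good set). [folklore] -/
def collisionCount (z : Config N d X) (t : ℝ) : ℕ :=
  sSup {k : ℕ | collisionInstant G ε z k ≤ ENNReal.ofReal t}

/-- The number of collisions of the forward dynamics in the half-open time window `[0, t)`: the
largest `k` with `t_k < t` (`0` if there is none, and the junk value `0` for accumulating
instants as in `collisionCount`). It differs from `collisionCount z t` exactly when `t` is a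
collision instant. [folklore] -/
def collisionCountBefore (z : Config N d X) (t : ℝ) : ℕ :=
  sSup {k : ℕ | collisionInstant G ε z k < ENNReal.ofReal t}

/-- The forward hard-sphere flow: `Φ_t z = S_{t - t_k} z_k` for `t ∈ [t_k, t_{k+1})`,
`k = collisionCount z t` — free flight from the last post-collisional state (right-continuous
in `t`: at a collision instant the value is post-collisional; CIP 1994 §4.2 p. 65, "Eqs. (2.1),
(2.2) and the free flow determine completely the time evolution"). Meaningful for `t ≥ 0` and
`z` in the good set. [cite: CIP1994, §4.2 p. 65] -/
def fwdFlow (z : Config N d X) (t : ℝ) : Config N d X :=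
  freeFlight G (t - (collisionInstant G ε z (collisionCount G ε z t)).toReal)
    (stateAfter G ε z (collisionCount G ε z t))

/-- The left-continuous version of the forward flow: `Φ_{t⁻} z = S_{t - t_k} z_k` for
`t ∈ (t_k, t_{k+1}]`, `k = collisionCountBefore z t` — at a collision instant the value is the
*pre*-collisional configuration `S_{τ(z_{k})} z_k`, elsewhere it agrees with `fwdFlow`. On good
orbits of the torus this is the left limit `Function.leftLim (fwdFlow z) t`; the algebraic form
avoids limits (and topology) in the definition of the backward flow. [folklore] -/
def fwdFlowLeft (z : Config N d X) (t : ℝ) : Config N d X :=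
  freeFlight G (t - (collisionInstant G ε z (collisionCountBefore G ε z t)).toReal)
    (stateAfter G ε z (collisionCountBefore G ε z t))

/-- The two-sided hard-sphere flow `T^t` (CIP 1994 §4.2 p. 65 and (2.3): `T^{-t} = S T^t S` on
`Γ₀`, `S` the velocity flip `flipVel`): the forward flow for `t ≥ 0`, and for `t < 0` the
velocity flip of the *left-continuous* forward flow of `flipVel z` at time `-t` — the flip
exchanges pre- and post-collisional configurations, so this is the choice that makes backward
orbits right-continuous, as `IsHardSphereTrajectory` requires (compare `Kinetic.timeReverse`,
which does the same with `Function.leftLim`). [cite: CIP1994, §4.2 (2.3)] -/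
def flow (t : ℝ) (z : Config N d X) : Config N d X :=
  if 0 ≤ t then fwdFlow G ε z t else flipVel (fwdFlowLeft G ε (flipVel z) (-t))

/-! ## The good set `Γ₀` -/

/-- `z` is a *simple incoming collision configuration*: there is an ordered pair `i < j` with
incoming velocities such that the pairs in contact in `z` are exactly `(i, j)` and `(j, i)` — a
binary, non-grazing, non-simultaneous collision (the configurations at which CIP 1994 §4.2 /
GST 2013 §4.1 apply the reflection law; multiple and grazing ones are "pathological",
GST 2013 p. 19). [cite: GST2013, §4.1 p. 19] -/
def IsSimpleIncoming (z : Config N d X) : Prop :=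
  ∃ p : Fin N × Fin N, p.1 < p.2 ∧ IsIncoming G z p.1 p.2 ∧
    ∀ i j : Fin N, i ≠ j → (z ∈ contactSet G N ε i j ↔ ({i, j} : Finset (Fin N)) = {p.1, p.2})

/-- Forward regularity of the collision-by-collision dynamics started at `z` (the negation of
GST 2013's "pathological trajectory", p. 19, and of CIP 1994 Thm. 4.2.1 (1)–(2), forward in
time): (i) whenever the `k`-th free flight ends (`τ(z_k) < ∞`) it ends in a simple incoming
collision configuration; (ii) strictly inside each free-flight segment no pair is in contact (no
grazing touch); (iii) the collision instants do not accumulate, `∑_k τ(z_k) = ∞`. [cite: GST2013, Prop. 4.1.1 p. 19] -/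
def FwdGood (z : Config N d X) : Prop :=
  (∀ k, freeExitTime G ε (stateAfter G ε z k) ≠ ∞ →
      IsSimpleIncoming G ε
        (freeFlight G (freeExitTime G ε (stateAfter G ε z k)).toReal (stateAfter G ε z k))) ∧
  (∀ k (t : ℝ), 0 < t → ENNReal.ofReal t < freeExitTime G ε (stateAfter G ε z k) →
      ∀ i j : Fin N, i ≠ j → freeFlight G t (stateAfter G ε z k) ∉ contactSet G N ε i j) ∧
  ∑' k, freeExitTime G ε (stateAfter G ε z k) = ∞

/-- The good set `Γ₀` of initial data (CIP 1994 §4.2 p. 65: phase points whose forward and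
backward evolutions meet only binary collisions without accumulation of collision instants;
GST 2013 Prop. 4.1.1: complement of the data leading to pathological trajectories), in the
right-continuous convention of `IsHardSphereTrajectory`: `z ∈ D_ε^N`; the pairs in contact in
`z` itself form at most one unordered pair, with outgoing velocities (a value at a collision
time is post-collisional); and both `z` and its velocity flip are forward-good (`FwdGood`; the
backward evolution of `z` is the flipped forward evolution of `flipVel z`, CIP 1994 (2.3)). [cite: CIP1994, §4.2 p. 65] -/
def good : Set (Config N d X) :=
  {z | z ∈ hardSphereDomain G N ε ∧
    (∀ i j : Fin N, i ≠ j → z ∈ contactSet G N ε i j →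
      IsOutgoing G z i j ∧
        ∀ i' j' : Fin N, i' ≠ j' → z ∈ contactSet G N ε i' j' →
          ({i', j'} : Finset (Fin N)) = {i, j}) ∧
    FwdGood G ε z ∧ FwdGood G ε (flipVel z)}

/-! ## Elementary API -/

variable {G ε}

/-- The good set lies in the hard-sphere domain. [folklore] -/
theorem good_subset_hardSphereDomain : good G ε ⊆ hardSphereDomain G N ε := fun _ hz => hz.1

/-- If the free flight never leaves the domain, the collision step is the identity. [folklore] -/
theorem collisionStep_of_eq_top {z : Config N d X} (h : freeExitTime G ε z = ∞) :
    collisionStep G ε z = z := by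
  simp [collisionStep, h]

/-- Before the exit time the free flight stays in the hard-sphere domain. [folklore] -/
theorem freeFlight_mem_hardSphereDomain_of_lt {z : Config N d X} {t : ℝ} (ht : 0 ≤ t)
    (h : ENNReal.ofReal t < freeExitTime G ε z) : freeFlight G t z ∈ hardSphereDomain G N ε := by
  by_contra hmem
  have hle : freeExitTime G ε z ≤ ENNReal.ofReal t :=
    sInf_le ⟨ENNReal.ofReal_ne_top, by rwa [ENNReal.toReal_ofReal ht]⟩
  exact (not_le.2 h) hle

/-- A configuration with positive exit time lies in the hard-sphere domain. [folklore] -/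
theorem mem_hardSphereDomain_of_freeExitTime_pos {z : Config N d X}
    (h : 0 < freeExitTime G ε z) : z ∈ hardSphereDomain G N ε := by
  simpa using freeFlight_mem_hardSphereDomain_of_lt (G := G) (ε := ε) (z := z) le_rfl
    (by simpa using h)

/-- The free flight never leaves the domain iff the exit time is infinite. [folklore] -/
theorem freeExitTime_eq_top_iff {z : Config N d X} :
    freeExitTime G ε z = ∞ ↔ ∀ t : ℝ, 0 ≤ t → freeFlight G t z ∈ hardSphereDomain G N ε := by
  constructor
  · intro h t ht
    exact freeFlight_mem_hardSphereDomain_of_lt ht (h ▸ ENNReal.ofReal_lt_top)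
  · intro h
    rw [freeExitTime, sInf_eq_top]
    rintro t ⟨ht, hmem⟩
    exact (hmem (h _ ENNReal.toReal_nonneg)).elim

/-- `z_0 = z`. [folklore] -/
@[simp]
theorem stateAfter_zero (z : Config N d X) : stateAfter G ε z 0 = z := rfl

/-- `z_{k+1} = T z_k`. [folklore] -/
theorem stateAfter_succ (z : Config N d X) (k : ℕ) :
    stateAfter G ε z (k + 1) = collisionStep G ε (stateAfter G ε z k) := by
  rw [stateAfter, stateAfter, iterate_succ_apply']

/-- The dynamics restarted from `z_k` has post-collisional states `z_{k+m}`. [folklore] -/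
theorem stateAfter_stateAfter (z : Config N d X) (k m : ℕ) :
    stateAfter G ε (stateAfter G ε z k) m = stateAfter G ε z (k + m) := by
  rw [stateAfter, stateAfter, stateAfter, ← iterate_add_apply, add_comm]

/-- `t_0 = 0`. [folklore] -/
@[simp]
theorem collisionInstant_zero (z : Config N d X) : collisionInstant G ε z 0 = 0 := by
  simp [collisionInstant]

/-- `t_{k+1} = t_k + τ(z_k)`. [folklore] -/
theorem collisionInstant_succ (z : Config N d X) (k : ℕ) :
    collisionInstant G ε z (k + 1) =
      collisionInstant G ε z k + freeExitTime G ε (stateAfter G ε z k) := by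
  rw [collisionInstant, collisionInstant, Finset.sum_range_succ]

/-- `t_1 = τ(z)`. [folklore] -/
@[simp]
theorem collisionInstant_one (z : Config N d X) :
    collisionInstant G ε z 1 = freeExitTime G ε z := by
  simp [collisionInstant_succ]

/-- The collision instants are nondecreasing in `k`. [folklore] -/
theorem monotone_collisionInstant (z : Config N d X) : Monotone (collisionInstant G ε z) := by
  refine monotone_nat_of_le_succ fun k => ?_
  rw [collisionInstant_succ]
  exact le_self_add

/-- Before the first collision no collision is counted: `collisionCount z t = 0` for
`t < τ(z)`. [folklore] -/
theorem collisionCount_eq_zero_of_lt {z : Config N d X} {t : ℝ}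
    (h : ENNReal.ofReal t < freeExitTime G ε z) : collisionCount G ε z t = 0 := by
  refine le_antisymm (csSup_le' fun k hk => ?_) (Nat.zero_le _)
  rcases Nat.eq_zero_or_pos k with hk0 | hk0
  · exact hk0.le
  have h1 : collisionInstant G ε z 1 ≤ collisionInstant G ε z k := monotone_collisionInstant z hk0
  rw [collisionInstant_one] at h1
  exact ((not_le.2 h) (h1.trans hk)).elim

/-- Up to the first collision instant included, no collision happened strictly before:
`collisionCountBefore z t = 0` for `t ≤ τ(z)`. [folklore] -/
theorem collisionCountBefore_eq_zero_of_le {z : Config N d X} {t : ℝ}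
    (h : ENNReal.ofReal t ≤ freeExitTime G ε z) : collisionCountBefore G ε z t = 0 := by
  refine le_antisymm (csSup_le' fun k hk => ?_) (Nat.zero_le _)
  rcases Nat.eq_zero_or_pos k with hk0 | hk0
  · exact hk0.le
  have h1 : collisionInstant G ε z 1 ≤ collisionInstant G ε z k := monotone_collisionInstant z hk0
  rw [collisionInstant_one] at h1
  exact ((not_lt.2 h) (h1.trans_lt hk)).elim

/-- Before the first collision the forward flow is free flight: `Φ_t z = S_t z` for
`t < τ(z)`. [folklore] -/
theorem fwdFlow_eq_freeFlight_of_lt {z : Config N d X} {t : ℝ}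
    (h : ENNReal.ofReal t < freeExitTime G ε z) : fwdFlow G ε z t = freeFlight G t z := by
  simp [fwdFlow, collisionCount_eq_zero_of_lt h]

/-- Up to the first collision instant included, the left-continuous forward flow is free
flight: `Φ_{t⁻} z = S_t z` for `t ≤ τ(z)`. [folklore] -/
theorem fwdFlowLeft_eq_freeFlight_of_le {z : Config N d X} {t : ℝ}
    (h : ENNReal.ofReal t ≤ freeExitTime G ε z) : fwdFlowLeft G ε z t = freeFlight G t z := by
  simp [fwdFlowLeft, collisionCountBefore_eq_zero_of_le h]

/-- `Φ_0 z = z` as soon as `τ(z) > 0` (in particular on the good set of the torus). [folklore] -/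
theorem fwdFlow_zero_of_pos {z : Config N d X} (h : 0 < freeExitTime G ε z) :
    fwdFlow G ε z 0 = z := by
  rw [fwdFlow_eq_freeFlight_of_lt (by simpa using h), freeFlight_zero]

/-- Free flight commutes with the velocity flip up to time reversal:
`S (S_t (S z)) = S_{-t} z` (CIP 1994 (2.3) for the free flow). [folklore] -/
theorem flipVel_freeFlight_flipVel (G : Geometry d X) (t : ℝ) (z : Config N d X) :
    flipVel (freeFlight G t (flipVel z)) = freeFlight G (-t) z := by
  funext i
  simp [smul_neg, neg_smul]

/-- For `t ≥ 0` the flow is the forward flow. [folklore] -/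
theorem flow_of_nonneg {t : ℝ} (ht : 0 ≤ t) (z : Config N d X) :
    flow G ε t z = fwdFlow G ε z t := by
  simp [flow, ht]

/-- For `t < 0` the flow is the flipped left-continuous forward flow of the flipped datum. [folklore] -/
theorem flow_of_neg {t : ℝ} (ht : t < 0) (z : Config N d X) :
    flow G ε t z = flipVel (fwdFlowLeft G ε (flipVel z) (-t)) := by
  simp [flow, not_le.2 ht]

/-- `T⁰ z = z` as soon as `τ(z) > 0`. [folklore] -/
theorem flow_zero_of_pos {z : Config N d X} (h : 0 < freeExitTime G ε z) : flow G ε 0 z = z := by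
  rw [flow_of_nonneg le_rfl, fwdFlow_zero_of_pos h]

/-- Before the first forward collision the flow is free flight: `T^t z = S_t z` for
`0 ≤ t < τ(z)`. [folklore] -/
theorem flow_eq_freeFlight_of_lt {z : Config N d X} {t : ℝ} (ht : 0 ≤ t)
    (h : ENNReal.ofReal t < freeExitTime G ε z) : flow G ε t z = freeFlight G t z := by
  rw [flow_of_nonneg ht, fwdFlow_eq_freeFlight_of_lt h]

/-- Back to the first backward collision the flow is free flight: `T^t z = S_t z` for
`t < 0` with `-t ≤ τ(S z)`. [folklore] -/
theorem flow_eq_freeFlight_of_neg {z : Config N d X} {t : ℝ} (ht : t < 0)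
    (h : ENNReal.ofReal (-t) ≤ freeExitTime G ε (flipVel z)) : flow G ε t z = freeFlight G t z := by
  rw [flow_of_neg ht, fwdFlowLeft_eq_freeFlight_of_le h, flipVel_freeFlight_flipVel, neg_neg]

/-- A datum that never collides, neither forward nor backward, moves by free flight for all
times. [folklore] -/
theorem flow_eq_freeFlight_of_eq_top {z : Config N d X} (h : freeExitTime G ε z = ∞)
    (h' : freeExitTime G ε (flipVel z) = ∞) (t : ℝ) : flow G ε t z = freeFlight G t z := by
  rcases le_or_gt 0 t with ht | ht
  · exact flow_eq_freeFlight_of_lt ht (h ▸ ENNReal.ofReal_lt_top)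
  · exact flow_eq_freeFlight_of_neg ht (h' ▸ le_top)

/-! ## The five facts about the construction on the torus, and the reduction of
`HardSphereFlow.nonempty_torus` to them -/

/-- **Group property and invariance of the good set** for the constructed hard-sphere flow on
`T^d`, `0 < ε < 1/2` (CIP 1994 §4.2 p. 65: "The family `{T^t}` is a group: `T⁰ = id`,
`T^t ∘ T^s = T^{t+s}`" on `Γ₀`, which is invariant): for every `N`, each `T^t` maps `Γ₀` to
itself, `T⁰ = id` on `Γ₀`, and `T^{s+t} = T^s ∘ T^t` on `Γ₀`. (Deterministic: restart of the
collision-by-collision dynamics from a point of an orbit, and reversibility via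
`collidePair_flipVel`.) [cite: CIP1994, §4.2 p. 65] -/
def torusFlow_group : Prop :=
  ∀ ⦃ε : ℝ⦄, 0 < ε → ε < 2⁻¹ → ∀ N : ℕ,
    (∀ t : ℝ, MapsTo (flow (N := N) (Torus.geometry d) ε t)
      (good (Torus.geometry d) ε) (good (Torus.geometry d) ε)) ∧
    (∀ z ∈ good (N := N) (Torus.geometry d) ε, flow (Torus.geometry d) ε 0 z = z) ∧
    (∀ s t : ℝ, ∀ z ∈ good (N := N) (Torus.geometry d) ε,
      flow (Torus.geometry d) ε (s + t) z = flow (Torus.geometry d) ε s (flow (Torus.geometry d) ε t z))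

/-- **Orbits of good points are hard-sphere trajectories** for the constructed flow on `T^d`,
`0 < ε < 1/2` (CIP 1994 §4.2 p. 65; GST 2013 §4.1, Def. 4.1.2: on `Γ₀` the evolution is free
flight between locally finitely many binary non-grazing collisions resolved by the reflection
law): for `z ∈ Γ₀`, `t ↦ T^t z` satisfies `Kinetic.IsHardSphereTrajectory`. [cite: CIP1994, §4.2 p. 65] -/
def torusFlow_isTrajectory : Prop :=
  ∀ ⦃ε : ℝ⦄, 0 < ε → ε < 2⁻¹ → ∀ N : ℕ, ∀ z ∈ good (N := N) (Torus.geometry d) ε,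
    IsHardSphereTrajectory (Torus.geometry d) ε N fun t => flow (Torus.geometry d) ε t z

/-- **Measurability** of the constructed flow on `T^d`, `0 < ε < 1/2`: the good set `Γ₀` is
measurable and each `T^t` is a measurable self-map of the phase space (the exit time is an
infimum over rational times of a jointly measurable expression, and the flow is assembled from
countably many measurable pieces; implicit in CIP 1994 App. 4.A–4.B, where `T^t` is integrated
against). [folklore] -/
def torusFlow_measurable : Prop :=
  ∀ ⦃ε : ℝ⦄, 0 < ε → ε < 2⁻¹ → ∀ N : ℕ,
    MeasurableSet (good (N := N) (Torus.geometry d) ε) ∧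
    ∀ t : ℝ, Measurable (flow (N := N) (Torus.geometry d) ε t)

/-- **Alexander's theorem** on `T^d`, `0 < ε < 1/2` (Alexander 1975; CIP 1994 Thm. 4.2.1
(1)–(2) with the torus proof of App. 4.A pp. 110–111; GST 2013 Prop. 4.1.1): the complement of
the good set `Γ₀` — initial data leading forward or backward to a multiple, simultaneous or
grazing collision or grazing touch, or to an accumulation of collision instants, together with
the null conventions at time `0` — is Liouville-null. [cite: Alexander1975]
[cite: CIP1994, Thm. 4.2.1 and App. 4.A pp. 110–111] [cite: GST2013, Prop. 4.1.1] -/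
def torusFlow_ae_good : Prop :=
  ∀ ⦃ε : ℝ⦄, 0 < ε → ε < 2⁻¹ → ∀ N : ℕ,
    liouville (Torus.geometry d) N ε (good (Torus.geometry d) ε)ᶜ = 0

/-- **Liouville's theorem for the hard-sphere flow** on `T^d`, `0 < ε < 1/2` (CIP 1994 §4.2 and
App. 4.A pp. 107–111: the free flow preserves Lebesgue measure and the collision map preserves
the boundary measure `dσ`, special flow representation; GST 2013, proof of Prop. 4.1.1: "the
measure is invariant by the flow"): each `T^t` preserves the Liouville measure
`liouville = dZ|_{D_ε^N}` (values off the null set `Γ₀ᶜ` being immaterial). [cite: CIP1994, App. 4.A pp. 107–111] -/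
def torusFlow_measurePreserving : Prop :=
  ∀ ⦃ε : ℝ⦄, 0 < ε → ε < 2⁻¹ → ∀ (N : ℕ) (t : ℝ),
    MeasurePreserving (flow (Torus.geometry d) ε t)
      (liouville (Torus.geometry d) N ε) (liouville (Torus.geometry d) N ε)

end Alexander

/-- **Reduction of Alexander's theorem to the five facts about the explicit construction**:
if the collision-by-collision flow `Kinetic.Alexander.flow` on `T^d` with good set
`Kinetic.Alexander.good` is a group of hard-sphere trajectories on an invariant, measurable,
Liouville-conull good set and preserves the Liouville measure, then
`HardSphereFlow (Torus.geometry d) ε N` is inhabited for all `0 < ε < 1/2` and `N`, i.e.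
`HardSphereFlow.nonempty_torus` holds. [cite: CIP1994, §4.2 p. 65] -/
theorem HardSphereFlow.nonempty_torus_of_construction
    (h_group : Alexander.torusFlow_group (d := d))
    (h_traj : Alexander.torusFlow_isTrajectory (d := d))
    (h_meas : Alexander.torusFlow_measurable (d := d))
    (h_ae : Alexander.torusFlow_ae_good (d := d))
    (h_mp : Alexander.torusFlow_measurePreserving (d := d)) :
    HardSphereFlow.nonempty_torus (d := d) := by
  intro ε hε hε' N
  obtain ⟨hmaps, h0, hadd⟩ := h_group hε hε' N
  exact ⟨{  flow := Alexander.flow (Torus.geometry d) ε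
            good := Alexander.good (Torus.geometry d) ε
            measurableSet_good := (h_meas hε hε' N).1
            good_subset := Alexander.good_subset_hardSphereDomain
            measure_compl_good := h_ae hε hε' N
            mapsTo_good := hmaps
            flow_zero := h0
            flow_add := hadd
            measurable_flow := (h_meas hε hε' N).2
            isTrajectory := h_traj hε hε' N
            measurePreserving := h_mp hε hε' N }⟩

end Kinetic

end

end Literature.Analysis.FluidPDE
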